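import Mathlib
import Summits.KontsevichZagierPeriods.Zeta5Search.ZeroWindowClasses
import Summits.KontsevichZagierPeriods.Zeta5Search.RecordWindowsA4
import Summits.KontsevichZagierPeriods.Zeta5Search.Ray4FrameL5
import Summits.KontsevichZagierPeriods.Zeta5Search.AtlasRay4
import Summits.KontsevichZagierPeriods.Zeta5Search.CellKitCentre
import Summits.KontsevichZagierPeriods.Zeta5Search.Ray4WindowsA4
import Summits.KontsevichZagierPeriods.Zeta5Search.FourthOrderResidue
import Summits.KontsevichZagierPeriods.Zeta5Search.RecordCellAAtlasNotMin
import Summits.KontsevichZagierPeriods.Zeta5Search.Ray4A4M56P1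
import Summits.KontsevichZagierPeriods.Zeta5Search.Ray4A4M56P2
import Summits.KontsevichZagierPeriods.Zeta5Search.Ray4A4M56P3
import Summits.KontsevichZagierPeriods.Zeta5Search.Ray4A4M56P4
import Summits.KontsevichZagierPeriods.Zeta5Search.Ray4A4M56P5
import Summits.KontsevichZagierPeriods.Zeta5Search.Ray4A4M56P6
import Summits.KontsevichZagierPeriods.Zeta5Search.Ray4A4M56P7
import Summits.KontsevichZagierPeriods.Zeta5Search.Ray4A4M56P8
import Summits.KontsevichZagierPeriods.Zeta5Search.Ray4A4M56P9
import Summits.KontsevichZagierPeriods.Zeta5Search.Ray4A4M56P10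
import Summits.KontsevichZagierPeriods.Zeta5Search.Ray4A4M56P11
import Summits.KontsevichZagierPeriods.Zeta5Search.Ray4A4M56P12
import Summits.KontsevichZagierPeriods.Zeta5Search.Ray4A4M56P13
import Summits.KontsevichZagierPeriods.Zeta5Search.Ray4A4M56P14
import Summits.KontsevichZagierPeriods.Zeta5Search.Ray4A4M56P15
import HarnessLib

/-!
# ζ(5) search — LawA4 (THEOREM A⁗, casLB + 4) RAY-4 window `M = 56` of `Ray4WindowsA4.lean`: `Ray4ClassesA4M56` (part 16/16)

HONEST FRAMING: systematic search; no irrationality claim unless certified.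

Cell `pub-zeta5`; typer seat generation 14.  MACHINE-GENERATED by typer g14 (`work/gen4/zwgen4.py` = p3 g3's `code/gen/zwgen.py` re-parametrised to ray 4)
in the format of P1's atlas machine (`AtlasCellRec*`) and p3 g3's `A4WindowM*`: exact scale-free class analysis of RAY 4 of the census
T1 map — `b = bLin (8n) (6n) n = n·(34; 14,13,12,11,10,9,8)` (g8 class #4; `b₀ = 34n`) — on the window `17 * n < 18 * p`, `p ≤ n`
(all odd `p` and all `n ≤ 300`: 1325 instances; class lengths `[34, 35, 36]`; bracket signatures per length `{34: 1, 35: 16, 36: 16}`);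
every statement then PROVED (`omega` leaf by leaf).  Bracket classification generated afresh (one LEAF theorem per signature;
decision tree inline in `zw_L*`).
Target: gen-2 g16's `@[conjecture]` node `Ray4Windows.Ray4ClassesA4M56` (`LawA4Classes (bLin (8n) (6n) n) p 56 T56R4`: one deep palindrome
`T56R4`, single raises at `−55`, admissible double raises at `−54`) and hence the window bound `Ray4Windows.Ray4WindowA4M56`
(-105) by gen-2 g16's landed reduction (THEOREM A⁗ `SecondOrder.lawA4_holds` inside).
Integer bookkeeping (`netExp` along residue classes); valuations of rationals; nothing here bears on irrationality.
-/

open Finset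

namespace Summit.KontsevichZagierPeriods.Zeta5Search.Ray4A4M56

open Summit.KontsevichZagierPeriods.Zeta5Search.ClusterValuation (netExp classSet CentreIn classExp conjClass bRec classPoleCount)
open Summit.KontsevichZagierPeriods.Zeta5Search.CasoratianValuation (InPolytope shift casoratian)
open Summit.KontsevichZagierPeriods.Zeta5Search.CellKit
open Summit.KontsevichZagierPeriods.Zeta5Search.SecondOrder (classTypeList isRaise isRaise2 classTypeList_level)
open Summit.KontsevichZagierPeriods.Zeta5Search.AtlasRay4
open Summit.KontsevichZagierPeriods.Zeta5Search.Ray4Windows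
open Summit.KontsevichZagierPeriods.Zeta5Search.RecordWindowsA4 (LawA4Classes)


variable {p : ℕ} [hp : Fact p.Prime]

/-- **`Ray4Windows.Ray4ClassesA4M56` IS A THEOREM**: the five class clauses of `LawA4` for ray 4 (`b = bLin (8 * n) (6 * n) n`; `M = 56`; `T = T56R4`)
on the window `17 * n < 18 * p`, `p ≤ n`, for every `n` and every odd prime of the window (the hypothesis `34n + 2 < p²` is not needed).
Per class the structure theorems `zw_L*` give the clauses with `classExp`; single-pole classes have `classNu ≥ classExp ≥ −6`
(tree lemmas `ResidueFour.neg_six_le_classExp_of_classPoleCount_le_one` and `CellA.classExp_le_classNu`); multipole classes have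
`classNu = classExp`. -/
theorem ray4ClassesA4M56_holds : Ray4ClassesA4M56 := by
  intro n p _hn hprime h1 h2 _hsq
  haveI : Fact p.Prime := ⟨hprime⟩
  have hp2 : p % 2 = 1 := by
    rcases hprime.eq_two_or_odd with rfl | h
    · have h4 : (2 : ℕ) ^ 2 = 4 := by norm_num
      omega
    · exact h
  have key : ∀ x, x < p →
      (-56 : ℤ) ≤ classExp (bLin (8 * n) (6 * n) n) p x ∧
      (classExp (bLin (8 * n) (6 * n) n) p x = -56 → ¬ CentreIn (bLin (8 * n) (6 * n) n) p x ∧ classTypeList (bLin (8 * n) (6 * n) n) p x = T56R4) ∧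
      (classExp (bLin (8 * n) (6 * n) n) p x = -55 →
        isRaise T56R4 (classTypeList (bLin (8 * n) (6 * n) n) p x) = true ∨
          (¬ (2 : ℤ) ∣ (bLin (8 * n) (6 * n) n) 0 ∧ CentreIn (bLin (8 * n) (6 * n) n) p x ∧ classTypeList (bLin (8 * n) (6 * n) n) p x = T56R4)) ∧
      (classExp (bLin (8 * n) (6 * n) n) p x = -54 → isRaise2 T56R4 (classTypeList (bLin (8 * n) (6 * n) n) p x) = true) := by
    intro x hx
    rcases Nat.lt_or_ge (34 * n) (x + 35 * p) with hL35 | hL35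
    · rcases Nat.lt_or_ge (34 * n) (x + 34 * p) with hL34 | hL34
      · exact zw_L33 h1 h2 hp2 hx (by omega) (by omega)
      · exact zw_L34 h1 h2 hp2 hx (by omega) (by omega)
    · exact zw_L35 h1 h2 hp2 hx (by omega) (by omega)
  have hnu : ∀ y, y < p → 1 ≤ classPoleCount (bLin (8 * n) (6 * n) n) p y → ClusterValuation.classNu (bLin (8 * n) (6 * n) n) p y ≤ -6 - 1 →
      ClusterValuation.classNu (bLin (8 * n) (6 * n) n) p y = classExp (bLin (8 * n) (6 * n) n) p y := by
    intro y _ _ hle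
    by_cases h1p : classPoleCount (bLin (8 * n) (6 * n) n) p y ≤ 1
    · have h6 := ResidueFour.neg_six_le_classExp_of_classPoleCount_le_one (bLin (8 * n) (6 * n) n) p y h1p
      have h7 := CellA.classExp_le_classNu (bLin (8 * n) (6 * n) n) p y
      omega
    · unfold ClusterValuation.classNu
      rw [if_neg (fun h => absurd h.1 (by omega))]
  unfold LawA4Classes
  refine ⟨fun x hx => ?_, fun y hy h1p => ?_, fun x hx hE => ?_, fun y hy hpc hny => ?_, fun z hz hpc hnz => ?_⟩
  · simp only [ClusterValuation.multipoleClasses, Finset.mem_filter, Finset.mem_range] at hx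
    exact (key x hx.1).1
  · have h6 := ResidueFour.neg_six_le_classExp_of_classPoleCount_le_one (bLin (8 * n) (6 * n) n) p y (by omega)
    have h7 := CellA.classExp_le_classNu (bLin (8 * n) (6 * n) n) p y
    omega
  · simp only [ClusterValuation.multipoleClasses, Finset.mem_filter, Finset.mem_range] at hx
    exact (key x hx.1).2.1 hE
  · have hcl := hnu y hy hpc (by omega)
    exact (key y hy).2.2.1 (by omega)
  · have hcl := hnu z hz hpc (by omega)
    exact (key z hz).2.2.2 (by omega)

/-- **`Ray4Windows.Ray4WindowA4M56` IS A THEOREM**: `v_p(Cas₇(b)) ≥ -105` (`= 7 − 2·56 = casLB + 4`) for `b = bLin (8 * n) (6 * n) n` at every prime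
of the ray-4 window `17 * n < 18 * p`, `p ≤ n` with `34n + 2 < p²` — UNCONDITIONAL: gen-2 g16's reduction `ray4WindowA4M56_of` (THEOREM A⁗ =
typer g12's `SecondOrder.lawA4_holds` discharged inside) + the class structure `ray4ClassesA4M56_holds`. -/
theorem ray4WindowA4M56_holds : Ray4WindowA4M56 := ray4WindowA4M56_of ray4ClassesA4M56_holds

end Summit.KontsevichZagierPeriods.Zeta5Search.Ray4A4M56
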